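import Mathlib
import HarnessLib
import HarnessLib.Audit
import Summits.Langlands.Statement
import HarnessLib.Audit.Status.Attr

/-!
Route: DisagreementBeurling

# Route DisagreementBeurling — Bad primes as a Beurling system — degree-zero quotient rigidity on
the Landau line closes Hessian strong Artin over every number field

It suffices to show X = K1 ∧ K2 ∧ D ∧ C36 (plus two finite/known supports) for the TARGET
StrongArtinHessian36 = direction (B) of the summit for irreducible Artin ρ : Γ_F → GL₃(ℂ) of 3²:4
("108") projective type over EVERY number field F, in the a.e. Satake form (`IsPiOfArtinRep`,
inlined) (SECTOR route: SectorComplement := StrongArtinHessian36 → Langlands is the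
honestly-labelled rest of the summit, filed unranked and not attacked; `closes` is sorry-free).
(K1, InteriorRigidity) there is no "T-pair-quotient package" with exponent b ∈ (1/2,1): an Euler
quotient Q_T(s) = ∏_{v∈T} L_v(α_v⊗ᾱ_v)/L_v(β_v⊗β̄_v) over a set T of finite places of F with unit
parameters, finite alphabet, leading defects |Σα_v|²−|Σβ_v|² ≥ δ > 0 and exponent of convergence b,
continued to ℂ as f/g with f, g entire of finite order, satisfying the self-dual functional equation
s ↔ 1−s up to w·B^s·cot(πs/2)^d and finitely many Euler-type corrections (rev 2: the package carries
NO clause on vertical progressions of poles). (K2, LandauLineNeverCentral) there is none with b =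
1/2. (D, ThinPairDichotomy, every rank n) for P cuspidal on GL_n(𝔸_F) of Artin infinity type and ρ
irreducible Artin of dimension n (rev 2: NO automorphy hypothesis on ρ⊗ρ̄⊖1), if at almost every
place the Satake class of P equals ρ(Frob_v) or misses it inside a finite alphabet with defect ≥ δ,
then EITHER P ↔ ρ a.e. OR the disagreement set carries such a package with b ∈ [1/2,1). (C36,
CanonicalDescent36) every 3²:4-type ρ has a cuspidal candidate P (JPSS non-normal cubic induction
over the quadratic layer, Arthur–Clozel descent pinned by det ρ) agreeing with ρ exactly off the
order-4 Frobenius classes and up to squares + determinant on them. Card realised: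
disagreement-set-beurling-rigidity (spine: K1 = its K1; K2 = its K2 WITHOUT the Lapidus–van
Frankenhuijsen no-AP input — withdrawn at rev 2, the lattice branch of Cohen's dichotomy is absorbed
by lattice factors instead; D = its Landau dichotomy + P1 + P2); the descent pattern and the defect
table are the sibling cards' inputs (hessian-descent-rs-positivity, lapid-ladder-separators,
hessian-first-blood-certificate), credited.
TYPING (route-repair 2026-08-15, cone hygiene; rev 1). Every item is typed over the import cone of
`Summits.Langlands.Statement` ALONE (route imports: none beyond the Statement's own). The vocabulary
of rev 0 is unfolded definitionally: `FramedArtinRep F n` = `FramedGaloisRep F ℂ n`;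
`projectiveImage ρ.toMonoidHom` = `(Matrix.ProjGenLinGroup.mk.comp ρ.toMonoidHom).range`;
`IsPiOfArtinRep ρ P.1` = `∀ᶠ v in cofinite, ∃ α, P.1.HasSatakeParamAt v α ∧ ρ.IsUnramifiedAt v ∧
ρ.HasFrobCharpolyAt v (satakePolynomial α)` (and `FrobSatakeCompatibleAt` = the inner clause);
`SatakeFamily F` = `HeightOneSpectrum (𝓞 F) → Multiset ℂ`; `zeroArchWeight` = `⟨0, 0, _⟩ :
ArchWeight`; `partialPairL Tᶜ α β s` = `∏' v : T, ((satakePairPolynomial (α v) (β v)).eval (q_v ^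
(-s)))⁻¹` (re-indexed over T). Each restated item is machine-checked equivalent to its rev-0
predecessor (Equiv.lean, Iff.rfl / tprod re-indexing, attached as item evidence); `closes` is
unchanged. The 26 unproved named facts of the four former imports (StrongArtinGL2 →
Langlands–Tunnell / newform / ERH / Deligne–Serre / Artin-conductor facts; AutomorphicLFunction's
multipliable_L, L_eq_partialStandardL_mul) were hypotheses of NO item and are gone from the cone;
needs-fact: none.
REV 2 (route-repair g2, 2026-08-15; statements, not cone — the cone was already clean: 0 unproved
facts among 311 constants). The no-AP conjunct `¬ ∃ τ > 0, ∀ᶠ k in cofinite, meromorphicOrderAt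
(f/g) (b + k·τ·I) < 0` is DELETED from the T-pair-quotient package in all three places:
InteriorRigidity and LandauLineNeverCentral become formally stronger (rev-2 ⇒ rev-1),
ThinPairDichotomy strictly weaker (rev-1 ⇒ rev-2); both implications and the unchanged `closes` are
machine-checked in Sketch.lean (rc 0, attached as item evidence). Reason: the clause's only supplier
is dead — NoVerticalAPZerosPos (the rev-1 '0 < b' repair of NoVerticalAPZeros) is FALSE at b = 1/2
under the abscissa-1 normalisation, witness G(s) = Σ_{j odd} j·(j²)^{-s} = (1 − 2^{1−2s})ζ(2s−1) (a
≥ 0, a 1 = 1, one simple pole at s = 1, polynomial growth on every right half-plane off the pole,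
and G(1/2 + ikπ/log 2) = 0 for EVERY k ∈ ℤ; found independently here and by the literature-prover of
wi-26106, evidence on stmt-Langlands-13939), and Lapidus–van Frankenhuijsen Thm 11.12 is false AS
PRINTED (status block of
Literature.NumberTheory.LFunctions.LapidusVanFrankenhuijsenVerticalProgressions: 'jumps of order D ⇒
oscillations of order D' fails for sprays with infinitely many frequencies); for the arithmetic
quotient no cofinite-AP exclusion on Re s = b ∈ [1/2, 1 − O(1/degree)) is in print either. And the
clause is NOT load-bearing: in K2 the lattice branch of Cohen's dichotomy (κ = finite part + Σ n_i
1_{x_i + τ_iℤ}, forced by discreteness of the divisor) is divided out by LATTICE FACTORS Λ(s) = ∏_i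
(1 − e^{−(2π/τ_i)(s − 1/2 − i x_i)})^{n_i} — entire of order 1, divisor exactly the lattices, almost
periodic and bounded away from 0 and ∞ on every line Re s ≠ 1/2, i.e. Euler-type corrections with
real base e^{2π/τ_i} — after which the Hadamard + Bohr endgame runs unchanged and ends in 'every
generalized Dirichlet coefficient of log Q_T + log Λ + log Eul vanishes' against c'_v ≥ δ on the
infinite set T (only finitely many v ∈ T have q_v a power of one fixed real base). Both no-AP
supports (NoVerticalAPZeros rev 0, NoVerticalAPZerosPos rev 1) are DROPPED: unique to this route ⇒
moot; their refutation evidence stays on stmt-Langlands-13718 / 13939 and in the Literature status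
block. SECOND rev-2 change: the hypothesis 'ρ⊗ρ̄ ⊖ 1 automorphic' is DELETED from ThinPairDichotomy
and the support AdjointAutomorphic36 is dropped — it served only the languidity/no-AP input (the
crux-attack refuter of stmt-Langlands-13934 concurs: 'H3 needed only for the no-AP clause'): f, g
entire of finite order with the package FE come from JPSS/Moeglin–Waldspurger for L^S(s, P×P̄) and
from Brauer induction + Hecke for the Artin L-function L^S(s, ρ⊗ρ̄) = A₀/B₀ (A₀, B₀ entire of order
1, functional equation as a meromorphic function; f := (s(1−s))^K L^S(P×P̄)·B₀, g := (s(1−s))^{K'}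
A₀·∏_{v∈S} L_v(ρ⊗ρ̄)^{-1}, the common factor B₀(s)B₀(1−s)-type terms cancel in the FE ratio), and b
< 1 from ord_1 L(s, ρ⊗ρ̄) = −⟨ρ⊗ρ̄, 1⟩ = −1 (Artin L-functions of non-trivial irreducibles are
regular and non-zero at s = 1, unconditionally). ThinPairDichotomy is thereby freed from Artin's
conjecture for Ad ρ and applies verbatim to insoluble images; `closes` loses the hypothesis h₆ (6
hypotheses, same proof), Assembly is restated without AdjointAutomorphic36 and is proved by `closes`
(Sketch.lean). needs-fact: none; imports unchanged (none beyond the Statement); items 12 → 9.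
Lean: `InteriorRigidity ∧ LandauLineNeverCentral ∧ ThinPairDichotomy ∧ CanonicalDescent36 ∧
DefectTable36`

## Assembly
Pure logic, sorry-free in Sketch.lean / glue.lean (`closes`, unchanged by both repairs): given F and
a 3²:4-type irreducible ρ, CanonicalDescent36 yields (hcpt, P, Artin infinity type, pattern);
DefectTable36 turns the pattern into ThinPairDichotomy's alphabet hypothesis (rev 2: no automorphy
input any more); ThinPairDichotomy at n = 3 returns the a.e. correspondence or a package with 1/2 ≤
b < 1; b = 1/2 is killed by LandauLineNeverCentral, 1/2 < b < 1 by InteriorRigidity; hence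
StrongArtinHessian36, and SectorComplement ends in _root_.Langlands. SparseMultiplicityOne is the
documented input of ThinPairDichotomy's proof (not a hypothesis of `closes`); the no-AP supports
NoVerticalAPZeros (rev 0) and NoVerticalAPZerosPos (rev 1) are both false on paper and dropped at
rev 2 — nothing in the route rests on Lapidus–van Frankenhuijsen Ch. 11 any more. REV 3 (badge
repair `route.target-unreachable`, 2026-08-16): the glue INTO the target is now an ITEM, by decl
NAME — support #9 HessianGlue36 : InteriorRigidity → LandauLineNeverCentral → ThinPairDichotomy →
CanonicalDescent36 → DefectTable36 → StrongArtinHessian36 — provable now by the eight lines of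
`closes` with SectorComplement peeled off (planner Sketch.lean: hessianGlue36_holds, rc 0, 0
sorries, axioms ⊆ {propext, Classical.choice, Quot.sound}; `closes` = SectorComplement ∘
HessianGlue36 and is unchanged); statements, badges (4 cruxes vetted), imports (none beyond the
Statement) and the cone (0 unproved named facts among 307 constants, gate deps check
2026-08-15T22:02Z; the payload's '10' is stale, cone view files absent) unchanged; needs-fact: none;
items 9 → 10.

Rationale: WHY THIS LINE. The last open solvable cases of strong Artin in rank 3 (Hessian types: Lapid1998 Rem.
3, Ramakrishnan2002, Martin2004) stall at ONE quadratic Arthur–Clozel descent whose sign ambiguity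
Rankin–Selberg positivity + Landau's lemma confine to a set T of bad places below the first real
zero β of ζ_F(s)·L(s, Ad ρ) (sibling cards; MartinRamakrishnan2016 Thm A is the n = 2 ancestor,
which uses the same two quotients L(π)/L(ρ), L(π×π̄)/L(ρ⊗ρ̄) but dodges the boundary exponent 1/2 by
base change + the GL₂ converse theorem, unavailable for n ≥ 4 and needing Kim–Shahidi bounds). This
line imports harmonic analysis on LCA groups and fractal-string theory into reciprocity: read T as a
Beurling prime system whose degree-zero zeta Q_T inherits a number-field functional equation; on its
Landau line Re s = β the function κ(t) = −ord_{β+it} Q_T is integer-valued and positive-definite on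
ℝ_d, so Bochner + Cohen's idempotent theorem (Cohen1960; Rudin1962FourierGroups Ch. 3) put κ in the
coset ring of ℝ_d, and discreteness of the divisor leaves a finite part plus finitely many full
lattices x_i + τ_iℤ of constant multiplicity (rev 2: the rev-0/1 exclusion of the lattice branch via
Lapidus–van Frankenhuijsen Thm 11.12 is WITHDRAWN — that theorem is false as printed and its
normalised variant NoVerticalAPZerosPos is false at b = 1/2 by Σ_{j odd} j^{1−2s}); the lattices are
divided out by lattice factors ∏_i (1 − e^{−(2π/τ_i)(s−1/2−ix_i)})^{n_i} (entire, order 1, almost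
periodic and bounded away from 0, ∞ on every other vertical line — Euler-type corrections with base
e^{2π/τ_i}), and then FE overlap at β = 1/2 + Hadamard (Boas1954) + Bohr almost periodicity and
uniqueness of generalized Dirichlet coefficients (Katznelson2004, MontgomeryVaughan2007) contradict
c'_v ≥ δ on the infinite set T: the Landau point is never central (K2). Below 1/2 the overlap
argument of MurtyMurty1994 / Kaczorowski2006Axiomatic Thm 2.3.2 / Soundararajan2002 closes
(SparseMultiplicityOne, credited); strictly inside (1/2,1) the honest residue is ONE
Estermann/Beurling-type rigidity statement for prime subsets carrying a functional equation (K1) —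
converse-theorem-free, separator-free and certificate-free, in every rank and over every F. What
prior routes do not do: the retired sector route HessianFirstBlood (ℚ only; not-a-thesis shape)
needed the JPSS GL₃ converse theorem and a ball-arithmetic certificate on the CLOSED interval
[1/2,1]; lapid-ladder-separators needs Sym²: GL₃ → GL₆; the negatives index (1 entry, K3
Kuga–Satake) is untouched.

RANKED CRUXES. #0 StrongArtinHessian36 (target) — direction (B) in the 3²:4 Artin sector, every
number field: for every irreducible ρ : Γ_F → GL₃(ℂ) whose projective image has order 36, trivial
centre and an element of order 4 (⇔ 3²:4, linear image of order 108) there is a cuspidal P on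
GL₃(𝔸_F) with P ↔ ρ almost everywhere (Satake class of P_v = ρ(Frob_v) at cofinitely many v; the
tree's `IsPiOfArtinRep ρ P`, inlined definitionally). Open since Langlands–Tunnell (Lapid1998 Rem.
3). (why it might fail: Via THIS line exactly as strong as InteriorRigidity: a real zero of
ζ_F(s)L(s, Ad ρ) in the OPEN interval (1/2,1) at which the bad places have their exponent is the one
configuration no item excludes unconditionally without K1.) [Lapid1998, Ramakrishnan2002,
Martin2004, MartinRamakrishnan2016]
#2 InteriorRigidity (crux) — (card K1, INTERIOR RIGIDITY, pure analysis) no T-pair-quotient package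
with exponent of convergence b ∈ (1/2,1) exists: for T a set of finite places of a number field F
and unit-circle multisets α_v, β_v (v ∈ T) of size n from a finite alphabet with |Σα_v|² − |Σβ_v|² ≥
δ > 0, Σ_{v∈T} q_v^{-σ} convergent exactly for σ > b, the quotient ∏_{v∈T} L_v(s, α_v⊗ᾱ_v)/L_v(s,
β_v⊗β̄_v) cannot equal f/g on Re s > 1 with f, g entire of finite order satisfying
f(s)g(1−s)·sin^{d₁}cos^{d₂}(πs/2)·∏(1−γq^{-s})·∏(1−γ'q^{s−1}) = w B^s
f(1−s)g(s)·cos^{d₁}sin^{d₂}(πs/2)·∏(…)·∏(…) (w ≠ 0, B > 0) (rev 2: no clause on vertical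
progressions of poles). [difficulty: open-problem] (why it might fail: Open in this generality
(prime Szegő): nothing yet forces the T-support of the coefficients inside |Re s − 1/2| < b − 1/2;
ONE deterministic T (e.g. primes a²+b⁴, exponent 3/4) whose quotient had such an FE refutes it as
typed.) [Kaczorowski2006Axiomatic, MurtyMurty1994, arXiv:1502.04175]
#3 LandauLineNeverCentral (crux) — (card K2 = (R2)+(R3), THE LANDAU POINT IS NEVER CENTRAL; rev 2:
package without the no-AP clause) no T-pair-quotient package with b = 1/2 exists. Proof plan: Q :=
f/g = Q_T on Re s > 1/2 (holomorphic, zero-free) and Q(s) = wB^s·(c₂/c₁)(s)·Q(1−s) puts the divisor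
of Q off the line Re s = 1/2 inside the explicit divisor of cot(πs/2)^d·(Euler-type corrections);
κ(t) := −ord_{1/2+it} Q = lim_{σ↓1/2} Σ_T c'_v q_v^{-σ-it}/log(1/(σ−1/2)) is ℤ-valued, bounded and
positive-definite on ℝ_d (c'_v ≥ δ > 0); Bochner + Cohen ⇒ κ in the coset ring of ℝ_d; closed
discrete support ⇒ κ = (finite part) + Σ_i n_i 1_{x_i+τ_iℤ} up to finite sets; lattice factors Λ :=
∏_i (1 − e^{−(2π/τ_i)(s−1/2−ix_i)})^{n_i} and a rational R cancel the divisor on the line,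
(Γ(s/2)/Γ((s+1)/2))^d and the Euler-type factors with zero-line left of 1/2 cancel it on Re s < 1/2
⇒ Φ := Q·Λ·R·Γ-ratio^d·Eul entire, zero-free, finite order = e^{P} (Hadamard); on Re s = σ₀ > 1 the
polynomial size of |Φ| forces Re P bounded ⇒ P affine and deg R = d/2; Q_T·Λ·Eul(σ₀+it) is Bohr
almost periodic and asymptotic to C e^{ic₁t}/M_± ⇒ equality ⇒ R·Γ-ratio^d constant ⇒ d = 0, R
constant ⇒ log Q_T + log Λ + log Eul affine ⇒ every generalized Dirichlet coefficient vanishes; but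
above every prime p prime to the correction bases and not a rational-power base of a lattice
(cofinitely many of the infinitely many primes below T) the lowest frequency f_min·log p comes only
from the k = 1 terms of the places of T over p of minimal degree, coefficient Σ c'_v ≥ δ > 0 —
contradiction (Landau's pole-order step of rev 1 is not needed). [difficulty: L] (why it might fail:
Coset-ring bookkeeping: closed discrete support must make κ 'finite + finitely many full lattices
x_i+τ_iℤ of constant multiplicity'; the Bohr step needs one line Re s = σ₀ where every correction
incl. the lattice factors is bounded away from 0, ∞ and the Γ-ratio has equal phases at ±∞.)
[Cohen1960, Rudin1962FourierGroups, Katznelson2004, Boas1954, MontgomeryVaughan2007,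
Kaczorowski2006Axiomatic]
#4 ThinPairDichotomy (crux) — (card PAYOFF in every rank: Landau dichotomy + P1 + P2 packaged) F a
number field, n ≥ 1, P cuspidal on GL_n(𝔸_F) with the Artin infinity type (all archimedean weights
(0,0)), ρ an irreducible n-dimensional Artin representation (rev 2: NO automorphy hypothesis on ρ⊗ρ̄
⊖ 1), and at almost every v the Satake class α of P and the Frobenius class β of ρ are unit
multisets with α = β or ((α,β) in a fixed finite alphabet and |Σα|² − |Σβ|² ≥ δ > 0). THEN either P
↔ ρ a.e. (`IsPiOfArtinRep`, inlined), or there are T, α, β, b with 1/2 ≤ b < 1 and the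
T-pair-quotient package of InteriorRigidity/LandauLineNeverCentral (same text; rev 2: WITHOUT any
clause on vertical progressions — no no-AP input is needed, and none is available:
NoVerticalAPZerosPos is false, LvF Thm 11.12 false as printed). Proof plan: T := disagreement set
minus the finite bad set S, b := its exponent; b < 1/2 (incl. T finite) ⇒ SparseMultiplicityOne ⇒ T
= ∅; else f := (s(1−s))^K L^S(s, P×P̄) (JPSS/Shahidi/MW: entire of order 1 after the polar factor),
g from the Artin L-function L^S(s, ρ⊗ρ̄) = A₀/B₀ (Brauer induction + Hecke: A₀, B₀ entire of order
1; f := (s(1−s))^K L^S(P×P̄)·B₀, g := (s(1−s))^{K'} A₀·∏_{v∈S} L_v(ρ⊗ρ̄)^{-1} — no automorphy of Ad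
ρ), f/g = Q_T on Re s > 1 because the local factors agree off S ∪ T, FE with γ-ratio = cot(πs/2)^d
because both sides have Artin-type Γ-factors of equal degree and the ramified ratio is a finite
Euler-type list, Landau ⇒ b is a singularity of Σ_T c'_v q_v^{-s} while ord_1(f/g) = 0 (ord_1 L(s,
ρ⊗ρ̄) = −⟨ρ⊗ρ̄, 1⟩ = −1 unconditionally: Artin L of non-trivial irreducibles is regular and non-zero
at 1) ⇒ b < 1. [difficulty: XL] (why it might fail: Packaging can leak: the FE shape
w·B^s·cot(πs/2)^d + Euler-type lists must absorb EVERY archimedean/ramified discrepancy (needs Artin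
type at all infinite places); the Brauer denominator B₀ must cancel cleanly in the FE ratio
((s(1−s))-powers, ramified lists); b < 1 needs L(1, Ad ρ) finite non-zero.)
[JacquetPiatetskiShapiroShalika1983, MoeglinWaldspurger1989, GodementJacquet1972,
JacquetShalikaAJM1981II, MurtyMurty1994, MontgomeryVaughan2007]
#5 CanonicalDescent36 (crux) — (sibling input, CANONICAL DESCENT over any F) for every irreducible
3²:4-type ρ : Γ_F → GL₃(ℂ) there is a cuspidal P on GL₃(𝔸_F) of Artin infinity type such that at
almost every v: unit Satake and Frobenius multisets α, β; α = β unless β has exactly two distinct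
squares (⇔ Frob_v of projective order 4 ⇔ v inert in the quadratic layer M₁), in which case α² = β²
as multisets and ∏α = ∏β. Construction: ρ|_{M₁} is monomial from a NON-normal cubic extension (JPSS
1981), hence P′ cuspidal on GL₃/M₁, Gal(M₁/F)-invariant; Arthur–Clozel quadratic descent to F,
pinned by ω_P = det ρ; M₁ is split at every real place (complex conjugation has projective order ≤
2), so P_∞ is of Artin type. [difficulty: XL] (why it might fail: Theorem-level (JPSS1981Cubique +
ArthurClozelAMS120 III.4.2, III.3.1 + CFT pinning) but far from formal; false as typed if some
projective-order-1,2,3 class had exactly two distinct squares (the card-2 test misfires) or P_w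
failed the (0,0) type at a complex place.) [JPSS1981Cubique, ArthurClozelAMS120, Lapid1998,
MartinRamakrishnan2016]
#9 DefectTable36 (support) — (finite computation; sibling N1 / refuter-verified table {1|5,5}) for
3²:4-type ρ the CanonicalDescent36 pattern implies the ThinPairDichotomy hypothesis with n = 3: at
an order-4 class the candidates with α² = β², ∏α = ∏β are β itself and two classes with |Σα|² = 5 >
1 = |Σβ|², so δ = 4 and the alphabet is the finite set of (candidate, Frobenius class) pairs of the
finite group ρ(Γ_F). [difficulty: M] [Lapid1998, MartinRamakrishnan2016, ArthurClozelAMS120]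
#9 SectorComplement (support) — the rest of the summit: (B) for 3²:4-type Artin ρ in the a.e. form ⇒
Langlands (upgrade a.e. to Corresponds by LLC + strong multiplicity one; all other Galois types,
weights, ranks; direction (A)). Not this route's business; filed so that `closes` ends in the summit
constant (convention of the sector routes of this summit: AnalyticDescent, GaloisWeightedBE,
MaassFreeConverse). [difficulty: open-problem] [BuzzardGeeLMS2014, FontaineMazurGeometric1995,
HarrisTaylorAMS2001]
#9 SparseMultiplicityOne (support) — (card P1 = (R1), SPARSE MIXED MULTIPLICITY ONE, credited to
Murty–Murty / Kaczorowski–Perelli / Soundararajan) P cuspidal on GL_n(𝔸_F) of Artin infinity type, ρ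
an n-dimensional Artin representation, T a set of places with Σ_{v∈T} q_v^{-σ} < ∞ for some σ < 1/2
at which ρ is unramified and P has unit Satake parameters, and Satake–Frobenius compatibility at
every v ∉ S ∪ T (S finite) ⇒ compatibility at every v ∈ T (`FrobSatakeCompatibleAt`, inlined).
Proof: E_χ = L(s, P⊗χ)/L(s, ρ⊗χ) is holomorphic non-vanishing on Re s > σ_T and, by the two
functional equations, off the explicit Γ/ramified divisor on Re s < 1 − σ_T; overlap ⇒
E_χ·(corrections) = e^{a+bs}; Bohr + σ → ∞ ⇒ E_χ is a finite Euler-type product;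
Dirichlet-coefficient comparison prime by prime, and finite-order Hecke twists χ separate the places
over p (Chevalley's theorem on units). [difficulty: L] [MurtyMurty1994, KaczorowskiPerelli2001,
Soundararajan2002, Kaczorowski2006Axiomatic, GodementJacquet1972]
#— DROPPED at rev 2: AdjointAutomorphic36 (stmt-Langlands-13937; automorphy of Ad ρ = M₄ ⊕ M₄′ by AI
through the cyclic quartic layer — true on paper, but consumed by nothing once ThinPairDichotomy
takes g from Brauer + Hecke) and the model-free no-AP supports NoVerticalAPZeros (rev 0,
stmt-Langlands-13718) / NoVerticalAPZerosPos (rev 1, stmt-Langlands-13939) — both FALSE on paper: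
witnesses (1 − 2^{-s})ζ(s) = Σ_{m odd} m^{-s} at b = 0 (refuters g43-1/g44-55; sorry-free Lean ¬ on
a verbatim replica, NV2.lean, proposal p64335) and (1 − 2^{1−2s})ζ(2s−1) = Σ_{j odd} j^{1−2s} at b =
1/2, θ = 0.49, τ = π/log 2 (this planner; independently the literature-prover of wi-26106); nothing
consumes them since the package lost its no-AP clause; unique to this route ⇒ moot; evidence kept on
the items and in the status block of
Literature.NumberTheory.LFunctions.LapidusVanFrankenhuijsenVerticalProgressions.

TWO-LAYER PLAN. Foreseen glued splits (none filed now; k ≤ 3, depth 1): ThinPairDichotomy ⇐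
PairQuotientPackage (f, g, FE of shape w·B^s·cot^d·Euler-lists for the disagreement set of (P, ρ):
JPSS/MW + Brauer–Hecke; neither automorphy of Ad ρ nor a no-AP clause since rev 2) → LandauExponent
(b := exponent of T; Landau ⇒ b is a pole ⇒ b < 1; b < 1/2 ⇒ SparseMultiplicityOne ⇒ T = ∅) →
ThinPairDichotomy. LandauLineNeverCentral ⇐ CohenBoundary (a ℤ-valued positive-definite κ on ℝ_d
with closed discrete support ⊂ ℝ is 'finite + Σ n_i 1_{x_i+τ_iℤ}' up to finite sets) →
CentralOverlap (such a divisor on Re s = 1/2 + lattice factors + FE + Hadamard + Bohr ⇒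
contradiction with δ > 0 on infinite T) → LandauLineNeverCentral. CanonicalDescent36 ⇐
MonomialOverQuadraticLayer (JPSS non-normal cubic AI over M₁; tree fact
automorphicInduction_character_cubic) → PinnedQuadraticDescent (Arthur–Clozel + ω_P = det ρ, local
pattern at split/inert places) → CanonicalDescent36.

KILL CRITERIA. An explicit T-pair-quotient package with b ∈ (1/2,1) refutes InteriorRigidity as
typed: close `refuted:InteriorRigidity` unless the witness is visibly non-arithmetic, in which case
pivot (route edit) to K1 restricted to packages of automorphic origin, i.e. the conditional sector
"no real zero of ζ_F·L(s, Ad ρ) in the OPEN interval (1/2,1)". A package with b = 1/2 (or a hole in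
the Cohen step that cannot be patched to 'finite + finitely many lattices') refutes
LandauLineNeverCentral and kills the mechanism: close `refuted:LandauLineNeverCentral`.
ThinPairDichotomy refuted-misstated (packaging leak: FE shape, finite order) ⇒ repaired item with
the enlarged correction class; refuted-substantive (a thin positive-defect pair with b outside
[1/2,1) ∪ agreement) ⇒ close. DefectTable36 / CanonicalDescent36 refuted ⇒ the Hessian input is
wrong: pivot the target to the q = 5, B = ℤ/3 rung (lapid-ladder table {1|4,7,7,13,13,25}) or close.
The no-AP supports are gone (rev 2, both false); a T-pair quotient of arithmetic origin carrying a
cofinite lattice of poles on Re s = 1/2 would refute nothing filed (K2's proof divides lattices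
out), but a package whose −ord along the line is positive-definite yet NOT 'finite + finitely many
lattices' exposes a hole in the Cohen bookkeeping ⇒ planner restates the package with the lattice
structure as an explicit clause (supplied inside D by Cohen) rather than closing.
StrongArtinHessian36 proved elsewhere (Sym²: GL₃ → GL₆, or a certificate route) moots the target but
not K1/K2/ThinPairDichotomy, which then migrate to the next rung.

NOT DECOMPOSED YET. The H₇₂ (3²:Q₈) and quintic (q = 5, B = ℤ/3) rungs — same InteriorRigidity /
LandauLineNeverCentral / ThinPairDichotomy, new descent + defect items only; the 648-type (cubic
step has ZERO defect, lapid-ladder L5) is out of reach of this mechanism and not claimed.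
Local–global compatibility at ramified places and the upgrade a.e. ⇒ Corresponds (junction's
business). The interior-infinitude law (R4), the li(x^b) and abelian-equidistribution laws of T
(consequences, not needed for `closes`). The Chevalley/Hecke-twist place separation and the Γ-ratio
= cot^d lemma (layer-2 lemmas of SparseMultiplicityOne / ThinPairDichotomy, attached by provers with
--supports). The classical analytic inputs flagged by grounders as absent from Mathlib (Cohen's
idempotent theorem and the coset-ring bookkeeping 'closed discrete ⇒ finite + lattices', Landau's
lemma MV Thm 1.7, Hadamard 'zero-free finite order = e^P', Stirling for Γ(s/2)/Γ((s+1)/2), Bohr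
almost periodicity and uniqueness of generalized Dirichlet coefficients) are proof-side facts for
literature-provers, not items.

CHEAPEST FALSIFIER. (i) Recompute the 3²:4 candidate table from the quadratic layer — done by the
novelty-audit refuter and again by refuters g43-3 / g43-35 (pure python over 3^{1+2}:C₄): {1 | 5,
5}, δ = 4, CONFIRMED (the Lean proof needs the eigenvalue-shape lemma λ{1, i, −i} at projective
order 4); (ii) a literature lookup for ANY Euler product over a thin set of primes (exponent in
[1/2,1)) with meromorphic continuation to ℂ AND a functional equation s ↔ 1−s (Estermann 1928 /
Dahlquist 1952 / Kurokawa 1986-type theorems give natural boundaries for ∏_p h(p^{-s}) over ALL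
primes — they support K1; a subset example would kill it; refuters' b = 1/2 attempt with the inert
places of a quadratic field fails the FE clause); (iii) [SETTLED at rev 2, negative] hypothesis (P)
of LvF Thm 11.12 gives NO no-AP input: the printed theorem is false (Literature status block, family
(1−2^{−(s−D)})ζ(s−D)) and under the abscissa-1 normalisation Σ_{j odd} j^{1−2s} =
(1−2^{1−2s})ζ(2s−1) vanishes at every 1/2 + ikπ/log 2 — hence the package carries no such clause and
nothing rests on LvF Ch. 11. (iv) Cheapest falsifier of the MECHANISM now: a meromorphic quotient of
finite-order entire functions whose divisor on a vertical line has positive-definite −ord (along the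
line, on ℝ_d) but is not 'finite Δ finitely many full lattices' — pure harmonic analysis (Cohen says
coset ring; the bookkeeping lemma says lattices); by hand on Dirichlet polynomials / Gamma
quotients, no kit job.

NUMBERS. Descent alphabet for 3²:4 from the quadratic layer: |tr|² ∈ {1 (true) | 5, 5} ⇒ c′_v = 4 =
δ (refuter-verified ×3); from the quartic layer {1, 1 | 5, 5, 9} (two minimisers — why Lapid's
E-descent is stuck). Quintic rung (q = 5, B = ℤ/3): {1 | 4, 7, 7, 13, 13, 25}.
MartinRamakrishnan2016: disagreement on degree-≥2 primes of a cyclic degree-p layer has exponent ≤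
1/2 (n = 2 closed there). Items at rev 1: 12 (1 target, 4 cruxes, 6 support, 1 assembly); rev 2: 9
(the two no-AP supports and AdjointAutomorphic36 dropped; InteriorRigidity, LandauLineNeverCentral
restated without the 136-character no-AP conjunct, ThinPairDichotomy without it and without the
740-character automorphy hypothesis, Assembly without AdjointAutomorphic36; rev-2 ⇒ rev-1 for K1/K2
and rev-1 + adjoint input ⇒ rev-2 for D machine-checked in Sketch.lean; closes: 6 hypotheses); route
imports beyond the Statement: 0 (rev 0: 4, dragging 26 unproved named facts); unproved constants in
the cone: 0 of 311 (gate deps check 2026-08-15T20:38Z).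

DEFINITION REQUESTS. None for statements. `ExponentOfConvergence` and `DisagreementSet` (card D1)
are inlined (Summable clauses over the subtype T; the compatibility clause ∃ α, HasSatakeParamAt ∧
IsUnramifiedAt ∧ HasFrobCharpolyAt (satakePolynomial α)); the Artin infinity type is `fun _ =>
Multiset.replicate n ⟨0, 0, _⟩` over `Literature.NumberTheory.Automorphic.ArchWeight` (= the barrier
file's `zeroArchWeight`, not imported); the package uses Mathlib's `meromorphicOrderAt`, `LSeries`,
`tprod` and the Statement-cone decls `satakePairPolynomial`, `satakePolynomial`, `FramedGaloisRep`,
`FramedRep.trace`, `CuspidalAutomorphicRepData`, `isCompact_glFiniteIntegralLevel`,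
`HeightOneSpectrum.residueCard`. FACT STATUS (no request):
`Literature.NumberTheory.LFunctions.LapidusVanFrankenhuijsen2006_thm11_12` is REFUTED as typed and
Theorem 11.12 is false as printed (module status block, wi-26106; Lean ¬ p64971 to be resubmitted);
NO corrected variant is wanted by this route — in particular not '0 < D' (false at D = 1/2 under the
abscissa-1 normalisation); never take that fact as a hypothesis.

Novelty: Searches (2026-08-15): `lit search "Euler product over a set of primes meromorphic continuation
functional equation natural boundary"` and `lit search "strong multiplicity one thin set exceptional
set exponent Selberg class"` (searchd rc 75 both times, as for the card author and critic); `lit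
galaxy search --star all`: "vertical arithmetic progressions of zeros" (3:
LapidusVanfrankenhuijsen2006, LvF 2000, Steuding LNM 1877), "Beurling generalized primes" (7:
Knopfmacher; Debruyne–Vindas ×3 incl. arXiv:1601.05324, arXiv:2411.03809; Zhang), "refinement of
strong multiplicity one" (1, arXiv:1103.4372, irrelevant), "natural boundaries of Euler products"
(0), "integer-valued Fourier-Stieltjes" (0), "idempotent measures integer-valued Fourier-Stieltjes
transform" (0); `lit read book:lapidus2006-fractal-geometry-complex-dimensions-zeta-functions` pp.
257–265 (Thm 11.1 three proofs, Rem. 11.2 cofinite, hypothesis (P), Thm 11.12 verbatim); `lit read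
arxiv:1502.04175` p. 2 (Thm A and the two quotients); `ledger negatives --problem Langlands` (1);
plus the card's and the mechanism critic's logged searches (zbMATH "vertical arithmetic progression
zeros" 4, "distinct zeros Selberg class" 16, "idempotent theorem Dirichlet series" 0, "refinement of
strong multiplicity one" 11; galaxy "multiplicity one for the Selberg class" 2, "arithmetic
progressions of zeros" 3–5).
Nearest prior art found: MartinRamakrishnan2016 = doi:10.1090/conm/664/13038 (Thm A: the same
quotients L(π)/L(ρ), L(π×π̄)/L(  [refs: 10.1090/conm/664/13038, 1601.05324, 2411.03809, 1103.4372, 1502.04175, math/0210299, book:lapidus2006-fractal-geometry-complex-dimensions-zeta-functions, arxiv:1502.04175, doi:10.1090/conm/664/13038, LapidusVanfrankenhuijsen2006, MartinRamakrishnan2016, MurtyMurty1994, KaczorowskiPerelli2001, Soundararajan2002, Cohen1960]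

Barriers (technique_class: degree-zero-rigidity, beurling-primes, idempotent-measures): - technique_class: degree-zero-rigidity, beurling-primes, idempotent-measures
- Literature.Barriers.Langlands.SolvableImageBarrier: met inside the soluble region (3²:4 is
Hessian, soluble) and evaded where the barrier's Arthur–Clozel quote leaves room ("base change ALONE
gives no new cases"): the added tool is complex/harmonic analysis of the residual degree-zero
quotient (Hadamard, Bochner–Cohen on ℝ_d, Lapidus–van Frankenhuijsen), outside the classes base
change / converse theorem / separator lift; nothing is claimed for insoluble images — there "ρ⊗ρ̄⊖1
automorphic" is Artin's conjecture for Ad ρ, so ThinPairDichotomy's hypothesis is unavailable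
(stated, not evaded).
- Literature.Barriers.Langlands.SolvableImageBarrierNarrow: not engaged — it blocks insoluble (A₅,
PSL₂(7)) images; no such claim.
- Literature.Barriers.Langlands.NonRegularWeightBarrier: evaded by construction — the Artin (weight
(0,0), non-regular) type enters only as the hypothesis `zeroArchWeight` (the barrier file's own
decl) and is handled by L-functions alone; no cohomology, p-adic interpolation or patching, so the
barrier's technique class is never entered.
- Literature.Barriers.Langlands.ShimuraVarietyRealizationBarrier: not engaged (direction (B) by
L-functions, nothing realised in cohomology); likewise TwistedEndoscopySelfDual,
TaylorWilesNumericalCoincidence, PatchingLocalComponentBarrier, ResiduallyReducibleBarrier,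
ModPLanglandsGL2BeyondQp, ShtukaConstantFieldBarrier. Uncatalogued and load-bearing

History (route lifecycle, newest last):
- 2026-08-15T20:37:39Z · rev 1: restated StrongArtinHessian36 (stmt-Langlands-13710), InteriorRigidity (stmt-Langlands-13711), LandauLineNeverCentral (stmt-Langlands-13712), ThinPairDichotomy (stmt-Langlands-13713), CanonicalDescent36 (stmt-Langlands-13714), DefectTable36 (stmt-Langlands-13715), AdjointAutomorphic36 (stmt-Langlands-13716), Spa (planner-rrepair-Langlands-DisagreementBeurling-ec3d23e3-0)
- 2026-08-15T22:02:29Z · rev 2: restated InteriorRigidity (stmt-Langlands-13932), LandauLineNeverCentral (stmt-Langlands-13933), ThinPairDichotomy (stmt-Langlands-13934), Assembly (stmt-Langlands-13720) — route-repair g2 (rev 2): cone already clean at rev 1 (0 unproved of 311 constants; payload's '11' stale, cone view files absent) — 0 imports (planner-rrepair-Langlands-DisagreementBeurling-ec3d23e3-g2-0)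
- 2026-08-15T22:02:29Z · rev 2: dropped NoVerticalAPZeros, NoVerticalAPZerosPos, AdjointAutomorphic36 — route-repair g2 (rev 2): cone already clean at rev 1 (0 unproved of 311 constants; payload's '11' stale, cone view files absent) — 0 imports dropped; STATEMENT (planner-rrepair-Langlands-DisagreementBeurling-ec3d23e3-g2-0)
- 2026-08-22T05:21:02Z · DORMANT — reconciler: no traction for 5.1 d (last activity item-evidence-added at 2026-08-17T02:27:51Z); parked, not closed — `ledger route dormant route-Langlands-Disagr (operator:999:1709677)
- 2026-08-31T22:26:38Z · REACTIVATED (open) — reconciler: reactivated — activity item-proof-filed at 2026-08-31T21:16:39Z after parking at 2026-08-22T05:21:02Z (operator:999:3499950)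

sub-problem: Langlands · status: open · opened planner-plancard-Langlands-Langlands-disagree-e066cc18-0 2026-08-15T20:14:07Z · rev 3 · ledger route-Langlands-DisagreementBeurling
GENERATED by the gate from the ledger (D-0016/17). Provers cite these decls: `theorem foo : Summit.Langlands.Langlands.Theses.DisagreementBeurling.<Decl> := …` in Summits/Langlands/Langlands/Theorems/<Name>.lean.
-/

namespace Summit.Langlands.Langlands.Theses.DisagreementBeurling

open scoped BigOperators Topology Manifold Classical MeasureTheory ProbabilityTheory Matrix InnerProductSpace ComplexConjugate ContinuousMap
open Filter Set Function TopologicalSpace MeasureTheory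

attribute [summit_statement] _root_.Langlands

-- earlier StrongArtinHessian36 (stmt-Langlands-13710, replaced 2026-08-15T20:37:39Z -> stmt-Langlands-13931): retired by None — ∀ (F : Type) [Field F] [NumberField F] (ρ : Literature.NumberTheory.GaloisRepresentations.FramedArtinRep F 3), ρ.toGaloisRep.IsIrreducible → (Nat.card (Literature.NumberTheory.GaloisRepresentations.projectiveImage ρ.toMonoidHom) = 36 ∧ Subgroup.center (Literature.NumberTheo
/-- item stmt-Langlands-13931 · target · rank 0 · open · by planner
why it might fail: Via THIS line exactly as strong as InteriorRigidity: a real zero of ζ_F(s)L(s, Ad ρ) in the OPEN interval (1/2,1) at which the bad places have their exponent is the one configuration no item excludes unconditionally without K1.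
sources: Lapid1998, Ramakrishnan2002, Martin2004, MartinRamakrishnan2016
[target] direction (B) in the 3²:4 Artin sector, every number field: for every irreducible ρ : Γ_F →
GL₃(ℂ) whose projective image has order 36, trivial centre and an element of order 4 (⇔ 3²:4, linear
image of order 108) there is a cuspidal P on GL₃(𝔸_F) with P ↔ ρ almost everywhere (Satake class of
P_v = ρ(Frob_v) at cofinitely many v; the tree's `IsPiOfArtinRep ρ P`, inlined definitionally). Open
since Langlands–Tunnell (Lapid1998 Rem. 3). -/
@[route_item "route-Langlands-DisagreementBeurling"]
def StrongArtinHessian36 : Prop :=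
  ∀ (F : Type) [Field F] [NumberField F] (ρ : Literature.NumberTheory.GaloisRepresentations.FramedGaloisRep F ℂ 3), ρ.toGaloisRep.IsIrreducible → (Nat.card (Matrix.ProjGenLinGroup.mk.comp ρ.toMonoidHom).range = 36 ∧ Subgroup.center (Matrix.ProjGenLinGroup.mk.comp ρ.toMonoidHom).range = ⊥ ∧ ∃ g : (Matrix.ProjGenLinGroup.mk.comp ρ.toMonoidHom).range, orderOf g = 4) → ∃ (hcpt : Literature.NumberTheory.Automorphic.isCompact_glFiniteIntegralLevel 3 F) (P : Literature.NumberTheory.Automorphic.CuspidalAutomorphicRepData 3 F hcpt), (∀ᶠ v in Filter.cofinite, ∃ α : Multiset ℂ, P.1.HasSatakeParamAt v α ∧ ρ.IsUnramifiedAt v ∧ ρ.HasFrobCharpolyAt v (Literature.NumberTheory.Automorphic.satakePolynomial α))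

-- earlier InteriorRigidity (stmt-Langlands-13711, replaced 2026-08-15T20:37:39Z -> stmt-Langlands-13932): retired by None — ∀ (F : Type) [Field F] [NumberField F] (n : ℕ) (T : Set (IsDedekindDomain.HeightOneSpectrum (NumberField.RingOfIntegers F))) (α β : Literature.NumberTheory.Automorphic.SatakeFamily F) (b : ℝ), 1 / 2 < b → b < 1 → ((∀ v ∈ T, Multiset.card (α v) = n ∧ Multiset.card (β v) = n ∧ (∀
-- earlier InteriorRigidity (stmt-Langlands-13932, replaced 2026-08-15T22:02:29Z -> stmt-Langlands-13860): retired by None — ∀ (F : Type) [Field F] [NumberField F] (n : ℕ) (T : Set (IsDedekindDomain.HeightOneSpectrum (NumberField.RingOfIntegers F))) (α β : IsDedekindDomain.HeightOneSpectrum (NumberField.RingOfIntegers F) → Multiset ℂ) (b : ℝ), 1 / 2 < b → b < 1 → ((∀ v ∈ T, Multiset.card (α v) = n ∧ 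
/-- item stmt-Langlands-13860 · crux · rank 2 · open · by planner
why it might fail: Open in this generality (prime Szegő): nothing yet forces the T-support of the coefficients inside |Re s − 1/2| < b − 1/2; ONE deterministic T (e.g. primes a²+b⁴, exponent 3/4) whose quotient had such an FE refutes it as typed.
sources: Kaczorowski2006Axiomatic, MurtyMurty1994, arXiv:1502.04175
[crux] (card K1, INTERIOR RIGIDITY, pure analysis; rev 2: package WITHOUT the no-AP conjunct —
formally stronger than rev 1, implication machine-checked in the planner's Sketch.lean) no
T-pair-quotient package with exponent of convergence b ∈ (1/2,1) exists: for T a set of finite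
places of a number field F and unit-circle multisets α_v, β_v (v ∈ T) of size n from a finite
alphabet with |Σα_v|² − |Σβ_v|² ≥ δ > 0, Σ_{v∈T} q_v^{-σ} convergent exactly for σ > b, the quotient
∏_{v∈T} L_v(s, α_v⊗ᾱ_v)/L_v(s, β_v⊗β̄_v) cannot equal f/g on Re s > 1 with f, g entire of finite
order (g ≢ 0) satisfying f(s)g(1−s)·sin^{d₁}cos^{d₂}(πs/2)·∏(1−γq^{-s})·∏(1−γ'q^{s−1}) = w B^s
f(1−s)g(s)·cos^{d₁}sin^{d₂}(πs/2)·∏(…)·∏(…) (w ≠ 0, B > 0; finitely many Euler-type corrections with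
integer bases q ≥ 2). NO clause on vertical progressions of poles: a periodic part of the divisor on
Re s = b is to be divided out by lattice factors inside any proof, as in LandauLineNeverCentral (the
rev-0/1 exclusion via Lapidus–van Frankenhuijsen Thm 11.12 is withdrawn — false as printed;
NoVerticalAPZerosPos false at b = 1/2). [difficulty: open-problem] -/
@[route_item "route-Langlands-DisagreementBeurling", crux]
def InteriorRigidity : Prop :=
  ∀ (F : Type) [Field F] [NumberField F] (n : ℕ) (T : Set (IsDedekindDomain.HeightOneSpectrum (NumberField.RingOfIntegers F))) (α β : IsDedekindDomain.HeightOneSpectrum (NumberField.RingOfIntegers F) → Multiset ℂ) (b : ℝ), 1 / 2 < b → b < 1 → ((∀ v ∈ T, Multiset.card (α v) = n ∧ Multiset.card (β v) = n ∧ (∀ a ∈ α v, ‖a‖ = 1) ∧ (∀ x ∈ β v, ‖x‖ = 1)) ∧ (Set.range (fun v : T => (α v.1, β v.1))).Finite ∧ (∃ δ : ℝ, 0 < δ ∧ ∀ v ∈ T, δ ≤ ‖(α v).sum‖ ^ 2 - ‖(β v).sum‖ ^ 2) ∧ (∀ σ : ℝ, b < σ → Summable (fun v : T => (v.1.residueCard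 : ℝ) ^ (-σ))) ∧ (∀ σ : ℝ, σ < b → ¬ Summable (fun v : T => (v.1.residueCard : ℝ) ^ (-σ))) ∧ ∃ (f g : ℂ → ℂ) (k : ℕ) (C : ℝ) (w : ℂ) (B : ℝ) (d₁ d₂ : ℕ) (N D N' D' : List (ℕ × ℂ)), Differentiable ℂ f ∧ Differentiable ℂ g ∧ (∃ s, g s ≠ 0) ∧ (∀ s, ‖f s‖ ≤ Real.exp (C * (1 + ‖s‖) ^ k)) ∧ (∀ s, ‖g s‖ ≤ Real.exp (C * (1 + ‖s‖) ^ k)) ∧ (∀ s : ℂ, 1 < s.re → f s = (∏' v : T, ((Literature.NumberTheory.Automorphic.satakePairPolynomial (α v.1) ((α v.1).map (starRingEnd ℂ))).eval ((v.1.residueCard : ℂ) ^ (-s)))⁻¹) / (∏' v : T, ((Literature.NumberTheory.Automorphic.satakePairPolynomial (β v.1) ((β v.1).map (starRingEnd ℂ))).eval ((v.1.residueCard : ℂ) ^ (-s)))⁻¹) * g s) ∧ w ≠ 0 ∧ 0 < B ∧ (∀ p ∈ N ++ D ++ N' ++ D', 2 ≤ p.1) ∧ (∀ s : ℂ, f s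 * g (1 - s) * Complex.sin (↑Real.pi * s / 2) ^ d₁ * Complex.cos (↑Real.pi * s / 2) ^ d₂ * (D.map (fun p => 1 - p.2 * (p.1 : ℂ) ^ (-s))).prod * (D'.map (fun p => 1 - p.2 * (p.1 : ℂ) ^ (s - 1))).prod = w * (B : ℂ) ^ s * f (1 - s) * g s * Complex.cos (↑Real.pi * s / 2) ^ d₁ * Complex.sin (↑Real.pi * s / 2) ^ d₂ * (N.map (fun p => 1 - p.2 * (p.1 : ℂ) ^ (-s))).prod * (N'.map (fun p => 1 - p.2 * (p.1 : ℂ) ^ (s - 1))).prod)) → False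

-- earlier LandauLineNeverCentral (stmt-Langlands-13712, replaced 2026-08-15T20:37:39Z -> stmt-Langlands-13933): retired by None — ∀ (F : Type) [Field F] [NumberField F] (n : ℕ) (T : Set (IsDedekindDomain.HeightOneSpectrum (NumberField.RingOfIntegers F))) (α β : Literature.NumberTheory.Automorphic.SatakeFamily F) (b : ℝ), b = 1 / 2 → ((∀ v ∈ T, Multiset.card (α v) = n ∧ Multiset.card (β v) = n ∧ (∀ a
-- earlier LandauLineNeverCentral (stmt-Langlands-13933, replaced 2026-08-15T22:02:29Z -> stmt-Langlands-13861): retired by None — ∀ (F : Type) [Field F] [NumberField F] (n : ℕ) (T : Set (IsDedekindDomain.HeightOneSpectrum (NumberField.RingOfIntegers F))) (α β : IsDedekindDomain.HeightOneSpectrum (NumberField.RingOfIntegers F) → Multiset ℂ) (b : ℝ), b = 1 / 2 → ((∀ v ∈ T, Multiset.card (α v) = n ∧ Mu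
/-- item stmt-Langlands-13861 · crux · rank 3 · open · by planner
why it might fail: Coset-ring bookkeeping: closed discrete support must make κ 'finite + finitely many full lattices x_i+τ_iℤ of constant multiplicity'; the Bohr step needs one line Re s = σ₀ where every correction incl. the lattice factors is bounded away from 0, ∞ and the Γ-ratio has equal phases at ±∞.
sources: Cohen1960, Rudin1962FourierGroups, Katznelson2004, Boas1954, MontgomeryVaughan2007, Kaczorowski2006Axiomatic
[crux] (card K2 = (R2)+(R3), THE LANDAU POINT IS NEVER CENTRAL; rev 2: package WITHOUT the no-AP
conjunct — formally stronger than rev 1, implication machine-checked) no T-pair-quotient package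
(same data as InteriorRigidity) with b = 1/2 exists. Proof plan (rev 2): Q := f/g equals Q_T on Re s
> 1/2 (holomorphic, zero-free) and Q(s) = wB^s·(c₂/c₁)(s)·Q(1−s), so off the line Re s = 1/2 the
divisor of Q lies in the explicit divisor of cot(πs/2)^{d₁−d₂} and of the Euler-type corrections;
κ(t) := −ord_{1/2+it} Q = lim_{σ↓1/2} Σ_T c'_v q_v^{-σ-it}/log(1/(σ−1/2)) is ℤ-valued, bounded and
positive-definite on ℝ_d (c'_v ≥ δ > 0) ⇒ Bochner + Cohen (Cohen1960; Rudin1962FourierGroups Ch. 3):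
κ lies in the coset ring of ℝ_d; closed discrete support ⇒ κ = finite part + Σ_i n_i 1_{x_i+τ_iℤ} up
to finite sets; LATTICE FACTORS Λ(s) = ∏_i (1 − e^{−(2π/τ_i)(s−1/2−ix_i)})^{n_i} (entire, order 1,
divisor = the lattices, almost periodic and bounded away from 0, ∞ on every line Re s ≠ 1/2 —
Euler-type corrections with real base e^{2π/τ_i}) and a rational R cancel the divisor on the line;
(Γ(s/2)/Γ((s+1)/2))^{d₁−d₂} and the Euler-type factors with zero-line left of 1/2 cancel it on Re s
< 1/2 ⇒ Φ := Q·Λ· -/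
@[route_item "route-Langlands-DisagreementBeurling", crux]
def LandauLineNeverCentral : Prop :=
  ∀ (F : Type) [Field F] [NumberField F] (n : ℕ) (T : Set (IsDedekindDomain.HeightOneSpectrum (NumberField.RingOfIntegers F))) (α β : IsDedekindDomain.HeightOneSpectrum (NumberField.RingOfIntegers F) → Multiset ℂ) (b : ℝ), b = 1 / 2 → ((∀ v ∈ T, Multiset.card (α v) = n ∧ Multiset.card (β v) = n ∧ (∀ a ∈ α v, ‖a‖ = 1) ∧ (∀ x ∈ β v, ‖x‖ = 1)) ∧ (Set.range (fun v : T => (α v.1, β v.1))).Finite ∧ (∃ δ : ℝ, 0 < δ ∧ ∀ v ∈ T, δ ≤ ‖(α v).sum‖ ^ 2 - ‖(β v).sum‖ ^ 2) ∧ (∀ σ : ℝ, b < σ → Summable (fun v : T => (v.1.residueCard : ℝ) ^ (-σ))) ∧ (∀ σ : ℝ, σ < b → ¬ Summable (fun v : T => (v.1.residueCard : ℝ) ^ (-σ))) ∧ ∃ (f g : ℂ → ℂ) (k : ℕ) (C : ℝ) (w : ℂ) (B : ℝ) (d₁ d₂ : ℕ) (N D N' D' : List (ℕ × ℂ)), Differentiable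 ℂ f ∧ Differentiable ℂ g ∧ (∃ s, g s ≠ 0) ∧ (∀ s, ‖f s‖ ≤ Real.exp (C * (1 + ‖s‖) ^ k)) ∧ (∀ s, ‖g s‖ ≤ Real.exp (C * (1 + ‖s‖) ^ k)) ∧ (∀ s : ℂ, 1 < s.re → f s = (∏' v : T, ((Literature.NumberTheory.Automorphic.satakePairPolynomial (α v.1) ((α v.1).map (starRingEnd ℂ))).eval ((v.1.residueCard : ℂ) ^ (-s)))⁻¹) / (∏' v : T, ((Literature.NumberTheory.Automorphic.satakePairPolynomial (β v.1) ((β v.1).map (starRingEnd ℂ))).eval ((v.1.residueCard : ℂ) ^ (-s)))⁻¹) * g s) ∧ w ≠ 0 ∧ 0 < B ∧ (∀ p ∈ N ++ D ++ N' ++ D', 2 ≤ p.1) ∧ (∀ s : ℂ, f s * g (1 - s) * Complex.sin (↑Real.pi * s / 2) ^ d₁ * Complex.cos (↑Real.pi * s / 2) ^ d₂ * (D.map (fun p => 1 - p.2 * (p.1 : ℂ) ^ (-s))).prod * (D'.map (fun p => 1 - p.2 * (p.1 : ℂ) ^ (s - 1))).prod = w * (B : ℂ) ^ s * f (1 - s)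 * g s * Complex.cos (↑Real.pi * s / 2) ^ d₁ * Complex.sin (↑Real.pi * s / 2) ^ d₂ * (N.map (fun p => 1 - p.2 * (p.1 : ℂ) ^ (-s))).prod * (N'.map (fun p => 1 - p.2 * (p.1 : ℂ) ^ (s - 1))).prod)) → False

-- earlier ThinPairDichotomy (stmt-Langlands-13713, replaced 2026-08-15T20:37:39Z -> stmt-Langlands-13934): retired by None — ∀ (F : Type) [Field F] [NumberField F] (n : ℕ), 0 < n → ∀ (hcpt : Literature.NumberTheory.Automorphic.isCompact_glFiniteIntegralLevel n F) (P : Literature.NumberTheory.Automorphic.CuspidalAutomorphicRepData n F hcpt) (ρ : Literature.NumberTheory.GaloisRepresentations.FramedArt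
-- earlier ThinPairDichotomy (stmt-Langlands-13934, replaced 2026-08-15T22:02:29Z -> stmt-Langlands-13862): retired by None — ∀ (F : Type) [Field F] [NumberField F] (n : ℕ), 0 < n → ∀ (hcpt : Literature.NumberTheory.Automorphic.isCompact_glFiniteIntegralLevel n F) (P : Literature.NumberTheory.Automorphic.CuspidalAutomorphicRepData n F hcpt) (ρ : Literature.NumberTheory.GaloisRepresentations.FramedGal
/-- item stmt-Langlands-13862 · crux · rank 4 · open · by planner
why it might fail: Packaging can leak: the FE shape w·B^s·cot(πs/2)^d + Euler-type lists must absorb EVERY archimedean/ramified discrepancy (needs Artin type at all infinite places); the Brauer denominator B₀ must cancel cleanly in the FE ratio; b < 1 needs ord_1 L(s,ρ⊗ρ̄) = −1 exactly.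
sources: JacquetPiatetskiShapiroShalika1983, MoeglinWaldspurger1989, GodementJacquet1972, JacquetShalikaAJM1981II, MurtyMurty1994, MontgomeryVaughan2007
[crux] (card PAYOFF in every rank: Landau dichotomy + P1 + P2 packaged; rev 2: NO automorphy
hypothesis on ρ⊗ρ̄⊖1 and output package WITHOUT the no-AP conjunct; rev-1 + the adjoint input ⇒
rev-2 machine-checked) F a number field, n ≥ 1, P cuspidal on GL_n(𝔸_F) with the Artin infinity type
(all archimedean weights (0,0)), ρ an irreducible n-dimensional Artin representation, and at almost
every v the Satake class α of P and the Frobenius class β of ρ are unit multisets with α = β or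
((α,β) in a fixed finite alphabet and |Σα|² − |Σβ|² ≥ δ > 0). THEN either P ↔ ρ a.e.
(`IsPiOfArtinRep`, inlined), or there are T, α, β, b with 1/2 ≤ b < 1 and the T-pair-quotient
package of InteriorRigidity/LandauLineNeverCentral (same text). Proof plan: T := disagreement set
minus the finite bad set S, b := its exponent; T finite ⇒ first disjunct directly; T infinite with b
< 1/2 ⇒ SparseMultiplicityOne ⇒ contradiction; else (1/2 ≤ b) build the package: f := (s(1−s))^K
L^S(s, P×P̄)·B₀(s) (JPSS/Shahidi/Moeglin–Waldspurger: L^S(P×P̄) has poles only at 0, 1 and finite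
order) and g := (s(1−s))^{K'} A₀(s)·∏_{v∈S} L_v(ρ⊗ρ̄, s)^{-1}, where the Artin L-function L(s, ρ⊗ρ̄)
= A₀/B₀ with A₀, B₀ entire of order 1 by -/
@[route_item "route-Langlands-DisagreementBeurling", crux]
def ThinPairDichotomy : Prop :=
  ∀ (F : Type) [Field F] [NumberField F] (n : ℕ), 0 < n → ∀ (hcpt : Literature.NumberTheory.Automorphic.isCompact_glFiniteIntegralLevel n F) (P : Literature.NumberTheory.Automorphic.CuspidalAutomorphicRepData n F hcpt) (ρ : Literature.NumberTheory.GaloisRepresentations.FramedGaloisRep F ℂ n), ρ.toGaloisRep.IsIrreducible → P.1.HasInfinityType (fun _ => Multiset.replicate n ({ a := 0, b := 0, exists_int_sub := ⟨0, (sub_zero (0 : ℂ)).trans Int.cast_zero.symm⟩ } : Literature.NumberTheory.Automorphic.ArchWeight)) → (∃ (δ : ℝ) (𝒜 : Set (Multiset ℂ × Multiset ℂ)), 0 < δ ∧ 𝒜.Finite ∧ ∀ᶠ v in Filter.cofinite, ∃ α β : Multiset ℂ, P.1.HasSatakeParamAt v α ∧ ρ.IsUnramifiedAt v ∧ ρ.HasFrobCharpolyAt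 v (Literature.NumberTheory.Automorphic.satakePolynomial β) ∧ (∀ a ∈ α, ‖a‖ = 1) ∧ (∀ x ∈ β, ‖x‖ = 1) ∧ (α = β ∨ ((α, β) ∈ 𝒜 ∧ δ ≤ ‖α.sum‖ ^ 2 - ‖β.sum‖ ^ 2))) → (∀ᶠ v in Filter.cofinite, ∃ α : Multiset ℂ, P.1.HasSatakeParamAt v α ∧ ρ.IsUnramifiedAt v ∧ ρ.HasFrobCharpolyAt v (Literature.NumberTheory.Automorphic.satakePolynomial α)) ∨ ∃ (T : Set (IsDedekindDomain.HeightOneSpectrum (NumberField.RingOfIntegers F))) (α β : IsDedekindDomain.HeightOneSpectrum (NumberField.RingOfIntegers F) → Multiset ℂ) (b : ℝ), 1 / 2 ≤ b ∧ b < 1 ∧ ((∀ v ∈ T, Multiset.card (α v) = n ∧ Multiset.card (β v) = n ∧ (∀ a ∈ α v, ‖a‖ = 1) ∧ (∀ x ∈ β v, ‖x‖ = 1)) ∧ (Set.range (fun v : T => (α v.1, β v.1))).Finite ∧ (∃ δ : ℝ, 0 < δ ∧ ∀ v ∈ T, δ ≤ ‖(α v).sum‖ ^ 2 - ‖(β v).sum‖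 ^ 2) ∧ (∀ σ : ℝ, b < σ → Summable (fun v : T => (v.1.residueCard : ℝ) ^ (-σ))) ∧ (∀ σ : ℝ, σ < b → ¬ Summable (fun v : T => (v.1.residueCard : ℝ) ^ (-σ))) ∧ ∃ (f g : ℂ → ℂ) (k : ℕ) (C : ℝ) (w : ℂ) (B : ℝ) (d₁ d₂ : ℕ) (N D N' D' : List (ℕ × ℂ)), Differentiable ℂ f ∧ Differentiable ℂ g ∧ (∃ s, g s ≠ 0) ∧ (∀ s, ‖f s‖ ≤ Real.exp (C * (1 + ‖s‖) ^ k)) ∧ (∀ s, ‖g s‖ ≤ Real.exp (C * (1 + ‖s‖) ^ k)) ∧ (∀ s : ℂ, 1 < s.re → f s = (∏' v : T, ((Literature.NumberTheory.Automorphic.satakePairPolynomial (α v.1) ((α v.1).map (starRingEnd ℂ))).eval ((v.1.residueCard : ℂ) ^ (-s)))⁻¹) / (∏' v : T, ((Literature.NumberTheory.Automorphic.satakePairPolynomial (β v.1) ((β v.1).map (starRingEnd ℂ))).eval ((v.1.residueCard : ℂ) ^ (-s)))⁻¹) * g s) ∧ w ≠ 0 ∧ 0 < B ∧ (∀ p ∈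 N ++ D ++ N' ++ D', 2 ≤ p.1) ∧ (∀ s : ℂ, f s * g (1 - s) * Complex.sin (↑Real.pi * s / 2) ^ d₁ * Complex.cos (↑Real.pi * s / 2) ^ d₂ * (D.map (fun p => 1 - p.2 * (p.1 : ℂ) ^ (-s))).prod * (D'.map (fun p => 1 - p.2 * (p.1 : ℂ) ^ (s - 1))).prod = w * (B : ℂ) ^ s * f (1 - s) * g s * Complex.cos (↑Real.pi * s / 2) ^ d₁ * Complex.sin (↑Real.pi * s / 2) ^ d₂ * (N.map (fun p => 1 - p.2 * (p.1 : ℂ) ^ (-s))).prod * (N'.map (fun p => 1 - p.2 * (p.1 : ℂ) ^ (s - 1))).prod))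

-- earlier CanonicalDescent36 (stmt-Langlands-13714, replaced 2026-08-15T20:37:39Z -> stmt-Langlands-13935): retired by None — ∀ (F : Type) [Field F] [NumberField F] (ρ : Literature.NumberTheory.GaloisRepresentations.FramedArtinRep F 3), ρ.toGaloisRep.IsIrreducible → (Nat.card (Literature.NumberTheory.GaloisRepresentations.projectiveImage ρ.toMonoidHom) = 36 ∧ Subgroup.center (Literature.NumberTheory
/-- item stmt-Langlands-13935 · crux · rank 5 · open · by planner
why it might fail: Theorem-level (JPSS1981Cubique + ArthurClozelAMS120 III.4.2, III.3.1 + CFT pinning) but far from formal; false as typed if some projective-order-1,2,3 class had exactly two distinct squares (the card-2 test misfires) or P_w failed the (0,0) type at a complex place.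
sources: JPSS1981Cubique, ArthurClozelAMS120, Lapid1998, MartinRamakrishnan2016
[crux] (sibling input, CANONICAL DESCENT over any F) for every irreducible 3²:4-type ρ : Γ_F →
GL₃(ℂ) there is a cuspidal P on GL₃(𝔸_F) of Artin infinity type such that at almost every v: unit
Satake and Frobenius multisets α, β; α = β unless β has exactly two distinct squares (⇔ Frob_v of
projective order 4 ⇔ v inert in the quadratic layer M₁), in which case α² = β² as multisets and ∏α =
∏β. Construction: ρ|_{M₁} is monomial from a NON-normal cubic extension (JPSS 1981), hence P′
cuspidal on GL₃/M₁, Gal(M₁/F)-invariant; Arthur–Clozel quadratic descent to F, pinned by ω_P = det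
ρ; M₁ is split at every real place (complex conjugation has projective order ≤ 2), so P_∞ is of
Artin type. [difficulty: XL] -/
@[route_item "route-Langlands-DisagreementBeurling", crux]
def CanonicalDescent36 : Prop :=
  ∀ (F : Type) [Field F] [NumberField F] (ρ : Literature.NumberTheory.GaloisRepresentations.FramedGaloisRep F ℂ 3), ρ.toGaloisRep.IsIrreducible → (Nat.card (Matrix.ProjGenLinGroup.mk.comp ρ.toMonoidHom).range = 36 ∧ Subgroup.center (Matrix.ProjGenLinGroup.mk.comp ρ.toMonoidHom).range = ⊥ ∧ ∃ g : (Matrix.ProjGenLinGroup.mk.comp ρ.toMonoidHom).range, orderOf g = 4) → ∃ (hcpt : Literature.NumberTheory.Automorphic.isCompact_glFiniteIntegralLevel 3 F) (P : Literature.NumberTheory.Automorphic.CuspidalAutomorphicRepData 3 F hcpt), P.1.HasInfinityType (fun _ => Multiset.replicate 3 ({ a := 0, b := 0, exists_int_sub := ⟨0, (sub_zero (0 : ℂ)).trans Int.cast_zero.symm⟩ } : Literature.NumberTheory.Automorphic.ArchWeight)) ∧ (∀ᶠ v in Filter.cofinite, ∃ α β : Multiset ℂ, P.1.HasSatakeParamAt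 v α ∧ ρ.IsUnramifiedAt v ∧ ρ.HasFrobCharpolyAt v (Literature.NumberTheory.Automorphic.satakePolynomial β) ∧ (∀ x ∈ β, ‖x‖ = 1) ∧ (∀ a ∈ α, ‖a‖ = 1) ∧ ((β.map (· ^ 2)).toFinset.card ≠ 2 → α = β) ∧ ((β.map (· ^ 2)).toFinset.card = 2 → α.map (· ^ 2) = β.map (· ^ 2) ∧ α.prod = β.prod))

/-- item stmt-Langlands-13717 · support · rank 9 · open · by planner
sources: BuzzardGeeLMS2014, FontaineMazurGeometric1995, HarrisTaylorAMS2001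
[support] the rest of the summit: (B) for 3²:4-type Artin ρ in the a.e. form ⇒ Langlands (upgrade
a.e. to Corresponds by LLC + strong multiplicity one; all other Galois types, weights, ranks;
direction (A)). Not this route's business; filed so that `closes` ends in the summit constant
(convention of the sector routes of this summit: AnalyticDescent, GaloisWeightedBE,
MaassFreeConverse). [difficulty: open-problem] -/
@[route_item "route-Langlands-DisagreementBeurling", crux]
def SectorComplement : Prop :=
  StrongArtinHessian36 → _root_.Langlands

-- earlier DefectTable36 (stmt-Langlands-13715, replaced 2026-08-15T20:37:39Z -> stmt-Langlands-13936): retired by None — ∀ (F : Type) [Field F] [NumberField F] (ρ : Literature.NumberTheory.GaloisRepresentations.FramedArtinRep F 3), ρ.toGaloisRep.IsIrreducible → (Nat.card (Literature.NumberTheory.GaloisRepresentations.projectiveImage ρ.toMonoidHom) = 36 ∧ Subgroup.center (Literature.NumberTheory.Galo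
/-- item stmt-Langlands-13936 · support · rank 9 · closed · proved by Summit.Langlands.Langlands.Theorems.DisagreementBeurlingDefectTable36.defectTable36 (prover) · by planner
sources: Lapid1998, MartinRamakrishnan2016, ArthurClozelAMS120
[support] (finite computation; sibling N1 / refuter-verified table {1|5,5}) for 3²:4-type ρ the
CanonicalDescent36 pattern implies the ThinPairDichotomy hypothesis with n = 3: at an order-4 class
the candidates with α² = β², ∏α = ∏β are β itself and two classes with |Σα|² = 5 > 1 = |Σβ|², so δ =
4 and the alphabet is the finite set of (candidate, Frobenius class) pairs of the finite group
ρ(Γ_F). [difficulty: M] -/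
@[route_item "route-Langlands-DisagreementBeurling", crux]
def DefectTable36 : Prop :=
  ∀ (F : Type) [Field F] [NumberField F] (ρ : Literature.NumberTheory.GaloisRepresentations.FramedGaloisRep F ℂ 3), ρ.toGaloisRep.IsIrreducible → (Nat.card (Matrix.ProjGenLinGroup.mk.comp ρ.toMonoidHom).range = 36 ∧ Subgroup.center (Matrix.ProjGenLinGroup.mk.comp ρ.toMonoidHom).range = ⊥ ∧ ∃ g : (Matrix.ProjGenLinGroup.mk.comp ρ.toMonoidHom).range, orderOf g = 4) → ∀ (hcpt : Literature.NumberTheory.Automorphic.isCompact_glFiniteIntegralLevel 3 F) (P : Literature.NumberTheory.Automorphic.CuspidalAutomorphicRepData 3 F hcpt), (∀ᶠ v in Filter.cofinite, ∃ α β : Multiset ℂ, P.1.HasSatakeParamAt v α ∧ ρ.IsUnramifiedAt v ∧ ρ.HasFrobCharpolyAt v (Literature.NumberTheory.Automorphic.satakePolynomial β) ∧ (∀ x ∈ β, ‖x‖ = 1) ∧ (∀ a ∈ α, ‖a‖ = 1) ∧ ((β.map (· ^ 2)).toFinset.card ≠ 2 → α = β) ∧ ((β.map (· ^ 2)).toFinset.card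 = 2 → α.map (· ^ 2) = β.map (· ^ 2) ∧ α.prod = β.prod)) → (∃ (δ : ℝ) (𝒜 : Set (Multiset ℂ × Multiset ℂ)), 0 < δ ∧ 𝒜.Finite ∧ ∀ᶠ v in Filter.cofinite, ∃ α β : Multiset ℂ, P.1.HasSatakeParamAt v α ∧ ρ.IsUnramifiedAt v ∧ ρ.HasFrobCharpolyAt v (Literature.NumberTheory.Automorphic.satakePolynomial β) ∧ (∀ a ∈ α, ‖a‖ = 1) ∧ (∀ x ∈ β, ‖x‖ = 1) ∧ (α = β ∨ ((α, β) ∈ 𝒜 ∧ δ ≤ ‖α.sum‖ ^ 2 - ‖β.sum‖ ^ 2)))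

-- `DefectTable36` holds: proved by `Summit.Langlands.Langlands.Theorems.DisagreementBeurlingDefectTable36.defectTable36` (its module imports this route file, so no `_holds` link can be stated here).

-- earlier SparseMultiplicityOne (stmt-Langlands-13719, replaced 2026-08-15T20:37:39Z -> stmt-Langlands-13938): retired by None — ∀ (F : Type) [Field F] [NumberField F] (n : ℕ), 0 < n → ∀ (hcpt : Literature.NumberTheory.Automorphic.isCompact_glFiniteIntegralLevel n F) (P : Literature.NumberTheory.Automorphic.CuspidalAutomorphicRepData n F hcpt) (ρ : Literature.NumberTheory.GaloisRepresentations.Frame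
/-- item stmt-Langlands-13938 · support · rank 9 · open · by planner
sources: MurtyMurty1994, KaczorowskiPerelli2001, Soundararajan2002, Kaczorowski2006Axiomatic, GodementJacquet1972
[support] (card P1 = (R1), SPARSE MIXED MULTIPLICITY ONE, credited to Murty–Murty /
Kaczorowski–Perelli / Soundararajan) P cuspidal on GL_n(𝔸_F) of Artin infinity type, ρ an
n-dimensional Artin representation, T a set of places with Σ_{v∈T} q_v^{-σ} < ∞ for some σ < 1/2 at
which ρ is unramified and P has unit Satake parameters, and Satake–Frobenius compatibility at every
v ∉ S ∪ T (S finite) ⇒ compatibility at every v ∈ T (`FrobSatakeCompatibleAt`, inlined). Proof: E_χ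
= L(s, P⊗χ)/L(s, ρ⊗χ) is holomorphic non-vanishing on Re s > σ_T and, by the two functional
equations, off the explicit Γ/ramified divisor on Re s < 1 − σ_T; overlap ⇒ E_χ·(corrections) =
e^{a+bs}; Bohr + σ → ∞ ⇒ E_χ is a finite Euler-type product; Dirichlet-coefficient comparison prime
by prime, and finite-order Hecke twists χ separate the places over p (Chevalley's theorem on units).
[difficulty: L] -/
@[route_item "route-Langlands-DisagreementBeurling"]
def SparseMultiplicityOne : Prop :=
  ∀ (F : Type) [Field F] [NumberField F] (n : ℕ), 0 < n → ∀ (hcpt : Literature.NumberTheory.Automorphic.isCompact_glFiniteIntegralLevel n F) (P : Literature.NumberTheory.Automorphic.CuspidalAutomorphicRepData n F hcpt) (ρ : Literature.NumberTheory.GaloisRepresentations.FramedGaloisRep F ℂ n) (S : Finset (IsDedekindDomain.HeightOneSpectrum (NumberField.RingOfIntegers F))) (T : Set (IsDedekindDomain.HeightOneSpectrum (NumberField.RingOfIntegers F))), P.1.HasInfinityType (fun _ => Multiset.replicate n ({ a := 0, b := 0, exists_int_sub := ⟨0, (sub_zero (0 : ℂ)).trans Int.cast_zero.symm⟩ } :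 Literature.NumberTheory.Automorphic.ArchWeight)) → (∃ σ : ℝ, σ < 1 / 2 ∧ Summable (fun v : T => (v.1.residueCard : ℝ) ^ (-σ))) → (∀ v ∈ T, ρ.IsUnramifiedAt v ∧ ∃ α : Multiset ℂ, P.1.HasSatakeParamAt v α ∧ ∀ a ∈ α, ‖a‖ = 1) → (∀ v, v ∉ S → v ∉ T → ∃ α : Multiset ℂ, P.1.HasSatakeParamAt v α ∧ ρ.IsUnramifiedAt v ∧ ρ.HasFrobCharpolyAt v (Literature.NumberTheory.Automorphic.satakePolynomial α)) → ∀ v ∈ T, ∃ α : Multiset ℂ, P.1.HasSatakeParamAt v α ∧ ρ.IsUnramifiedAt v ∧ ρ.HasFrobCharpolyAt v (Literature.NumberTheory.Automorphic.satakePolynomial α)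

/-- item stmt-Langlands-14439 · support · rank 9 · closed · proved by Summit.Langlands.Langlands.Theorems.DisagreementBeurlingHessianGlue36.hessianGlue36 (prover) · by planner
sources: planner Sketch.lean hessianGlue36_holds (lean check rc 0, 2026-08-16), MartinRamakrishnan2016, Lapid1998
[support] GLUE INTO THE TARGET, by item NAME (rev 3, badge repair of `route.target-unreachable`:
until now no ITEM concluded the rank-0 target — the deciding theorem `closes` proved
StrongArtinHessian36 inline and handed it to SectorComplement). The two analytic cruxes, the
dichotomy, the descent and the defect table give the target: InteriorRigidity →
LandauLineNeverCentral → ThinPairDichotomy → CanonicalDescent36 → DefectTable36 →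
StrongArtinHessian36. PROVABLE NOW, pure logic — the body of `closes` with SectorComplement peeled
off: given F and an irreducible 3²:4-type ρ, CanonicalDescent36 yields (hcpt, P, Artin infinity
type, local pattern); DefectTable36 turns the pattern into ThinPairDichotomy's
finite-alphabet/defect hypothesis at n = 3; ThinPairDichotomy returns the a.e. Satake–Frobenius
correspondence (= the target's conclusion) or a T-pair-quotient package with 1/2 ≤ b < 1; b = 1/2 is
excluded by LandauLineNeverCentral and 1/2 < b < 1 by InteriorRigidity. Planner sketch (Sketch.lean
`hessianGlue36_holds`, lean check rc 0, 0 sorries, axioms ⊆ {propext, Classical.choice, Quot.sound},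
2026-08-16): `intro h₁ h₂ h₃ h₄ h₅ F _ _ ρ hirr htype; obtain ⟨hcpt, P, hinf, hpat⟩ := h₄ F -/
@[route_item "route-Langlands-DisagreementBeurling"]
def HessianGlue36 : Prop :=
  InteriorRigidity → LandauLineNeverCentral → ThinPairDichotomy → CanonicalDescent36 → DefectTable36 → StrongArtinHessian36

-- `HessianGlue36` holds: proved by `Summit.Langlands.Langlands.Theorems.DisagreementBeurlingHessianGlue36.hessianGlue36` (its module imports this route file, so no `_holds` link can be stated here).

-- earlier Assembly (stmt-Langlands-13720, replaced 2026-08-15T22:02:29Z -> stmt-Langlands-13863): retired by None — InteriorRigidity → LandauLineNeverCentral → ThinPairDichotomy → CanonicalDescent36 → DefectTable36 → AdjointAutomorphic36 → SectorComplement → _root_.Langlands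
/-- item stmt-Langlands-13863 · assembly · rank 1 · closed · proved by Summit.Langlands.Langlands.Theorems.disagreementBeurling_assembly_proof (prover) · by planner
sources: BuzzardGeeLMS2014, MartinRamakrishnan2016
[assembly] InteriorRigidity → LandauLineNeverCentral → ThinPairDichotomy → CanonicalDescent36 →
DefectTable36 → SectorComplement → Langlands (rev 2: AdjointAutomorphic36 removed; this is exactly
the type of the deciding theorem `closes`, which proves it — Sketch.lean `assembly_holds`). -/
@[route_item "route-Langlands-DisagreementBeurling"]
def Assembly : Prop :=
  InteriorRigidity → LandauLineNeverCentral → ThinPairDichotomy → CanonicalDescent36 → DefectTable36 → SectorComplement → _root_.Langlands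

-- `Assembly` holds: proved by `Summit.Langlands.Langlands.Theorems.disagreementBeurling_assembly_proof` (its module imports this route file, so no `_holds` link can be stated here).

-- records of items no longer active in this route (dropped / restated):
-- earlier AdjointAutomorphic36 (stmt-Langlands-13716, replaced 2026-08-15T20:37:39Z -> stmt-Langlands-13937): retired by None — ∀ (F : Type) [Field F] [NumberField F] (ρ : Literature.NumberTheory.GaloisRepresentations.FramedArtinRep F 3), ρ.toGaloisRep.IsIrreducible → (Nat.card (Literature.NumberTheory.GaloisRepresentations.projectiveImage ρ.toMonoidHom) = 36 ∧ Subgroup.center (Literature.NumberTheo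

/-! D-0027 §2.1 — DECIDING THEOREM (planner-authored via `route open/edit --closes-file`; by planner-rrepair-Langlands-DisagreementBeurling-ec3d23e3-g2-0 2026-08-15T22:02:29Z):
its hypotheses are this route's items and its conclusion the sub-problem Statement (glue_lint), and it elaborates with this file. -/

@[closes "route-Langlands-DisagreementBeurling"] theorem closes (h₁ : InteriorRigidity) (h₂ : LandauLineNeverCentral) (h₃ : ThinPairDichotomy)
    (h₄ : CanonicalDescent36) (h₅ : DefectTable36) (h₇ : SectorComplement) : _root_.Langlands := by
  refine h₇ ?_
  intro F _ _ ρ hirr htype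
  obtain ⟨hcpt, P, hinf, hpat⟩ := h₄ F ρ hirr htype
  refine ⟨hcpt, P, ?_⟩
  rcases h₃ F 3 (by norm_num) hcpt P ρ hirr hinf (h₅ F ρ hirr htype hcpt P hpat) with h | ⟨T, α, β, b, hb1, hb2, hP⟩
  · exact h
  · exfalso
    rcases hb1.eq_or_lt with h12 | h12
    · exact h₂ F 3 T α β b h12.symm hP
    · exact h₁ F 3 T α β b h12 hb2 hP

end Summit.Langlands.Langlands.Theses.DisagreementBeurling
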